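/-
Copyright (c) 2026 the pub-hodgecm-mathlib formalisation cell (harness21).  Prover seat hodgecm-mathlib-K2E3-p25 (g0), HCML Track B «K2-LIT»,
h413 = `stmt-HodgeConjecture-24833`, road (11-3-split-nsc), leaf (nsc-S-A′) `sig_K2E3GL3PrincipalBlockStandardSpan`, brick E3α «MULTIPLICITIES ALONG A FILTRATION
BY LINES» of the leaf owner's memo `K2/K2E3-p25/g0/MEMO-SA-architecture.v1.K2E3-p25-g0.md`.  2026-09-04.
-/
import Summits.HodgeConjecture.HodgeConjecture.Theorems.K2E3JacquetExponentEigenvector   -- ★ E1b (brings ★ E1a `K2E3JacquetExponentMultiset`)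
import HarnessLib

/-!
# K2_E3 road (h413), leaf (nsc-S-A′), brick E3α — exponent multiplicities of a representation filtered by LINES with known characters

Cell `pub/hodgecm-mathlib` (D-0151), Track B, seat K2E3-p25 (g0) (leaf owner of (nsc-S-A′)).  `--supports stmt-HodgeConjecture-24833 --as helper`; THEOREMS ONLY
(no definition ∕ instance ∕ notation ∕ named fact ∕ `sorry`); generic linear algebra over ★ E1a∕E1b; never imports `Cruxes/…/Lines`.  COUNT-NEUTRAL.

THE MATHEMATICS ([BernsteinZelevinsky1977, §2.12 Geometrical Lemma, Cor. 2.13 (c)]; [Casselman1995, §6.3 Thm. 6.3.5]).  This is the bookkeeping half of the geometric lemma: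
once the Jacquet module `J = r_B(I)` of an induced representation has been filtered along the Bruhat cells, `J = F₀ ⊇ F₁ ⊇ … ⊇ F_n = 0`, with each graded piece
`F_k ⁄ F_{k+1}` a LINE on which the torus acts by a known character `c_k` — packaged, as the cell analysis delivers it, by a linear functional `Λ_k` on `J` whose kernel
on `F_k` is exactly `F_{k+1}`, which does not vanish on `F_k`, and which is `c_k`-equivariant on `F_k` — then `J` is finite-dimensional of dimension `n` and, for every
`χ : M → ℂ`, the multiplicity of `χ` (dimension of the simultaneous generalised eigenspace, ★ E1a) is the NUMBER OF INDICES `k < n` WITH `c_k = χ`: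
* `finrank_weightSpace_step` — one step `S′ ≤ S`: `dim S_χ = dim S′_χ + [χ = c]`;
* **`finrank_weightSpace_eq_card_of_lineFiltration`** — `J` finite-dimensional and `dim J_χ = #{k < n : c_k = χ}`.
(Descending induction on `k` with ★ E1a `finrank_weightSpace_eq_add_of_exact` on `0 → F_{k+1} → F_k →^{Λ_k} ℂ_{c_k} → 0` and ★ E1b for the character line.)  The commuting-action
hypothesis is that of E1a (`M` = the diagonal torus of `GL₃`, commutative).  Consumer: the GL₃ Borel geometric lemma (E3γ∕E3δ: the six Bruhat cells give such a filtration of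
`r_B(Ind_B^{GL₃} θ)` with `c_σ = σ⁻¹·θ`).

HONEST LABEL: HC_CM is proved only modulo the 7 printed citations (2 remaining named inputs: hLiu418 = stmt-HodgeConjecture-24832, h413 = stmt-HodgeConjecture-24833) until rung 0
closes; count-neutral generic helper.

## References
* [BernsteinZelevinsky1977] I. N. Bernstein, A. V. Zelevinsky, *Induced representations of reductive p-adic groups I*, Ann. Sci. ÉNS 10 (1977), §2.12, Cor. 2.13 (c), Thm. 5.2.
* [Casselman1995] W. Casselman, *Introduction to the theory of admissible representations of p-adic reductive groups* (draft 1 May 1995), §6.3 (Thm. 6.3.5), Lemma 7.1.1.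
-/

set_option autoImplicit false
set_option linter.dupNamespace false

noncomputable section

open Module Module.End Set Function

namespace Summit.HodgeConjecture.HodgeConjecture.Cruxes.H413.K2E3JacquetFiltrationMultiplicity

open Summit.HodgeConjecture.HodgeConjecture.Cruxes.H413.K2E3JacquetExponentMultiset
open Summit.HodgeConjecture.HodgeConjecture.Cruxes.H413.K2E3JacquetExponentEigenvector

universe u v

variable {M : Type u} [Group M]
variable {J : Type v} [AddCommGroup J] [Module ℂ J]

/-! ## §1 Restricting a representation to a stable submodule -/

/-- The restriction of `τ` to a `τ`-stable submodule `S`, as an explicit function `M → End S` (no `def`: packaged where used). [folklore] -/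
theorem restrict_mul_eq (τ : Representation ℂ M J) (S : Submodule ℂ J) (hS : ∀ m, ∀ x ∈ S, τ m x ∈ S) (m m' : M) :
    (τ (m * m')).restrict (fun x hx => hS (m * m') x hx) = (τ m).restrict (fun x hx => hS m x hx) * (τ m').restrict (fun x hx => hS m' x hx) := by
  ext x
  simp [Module.End.mul_apply]

/-! ## §2 One step: a stable submodule `S' ≤ S` cut out by an equivariant functional -/

/-- **One filtration step.**  `S' ≤ S` are `τ`-stable submodules (pairwise commuting action), `S'` finite-dimensional, and `Λ : J → ℂ` is a linear functional with
`ker Λ ∩ S = S'`, `Λ|_S ≠ 0`, and `Λ(τ(m)x) = c(m) Λ(x)` for `x ∈ S`.  Then `S` is finite-dimensional and for every `χ`,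
`dim S_χ = dim S'_χ + [χ = c]` (multiplicities of the restricted actions; the quotient `S ⁄ S'` is a line on which `M` acts by `c`).
[cite: BernsteinZelevinsky1977, Cor. 2.13 (c)] [cite: Casselman1995, §6.3 Thm. 6.3.5] -/
theorem finrank_weightSpace_step (τ : Representation ℂ M J) (hτ : ∀ m m' : M, Commute (τ m) (τ m'))
    (S S' : Submodule ℂ J) (hle : S' ≤ S) (hS : ∀ m, ∀ x ∈ S, τ m x ∈ S) (hS' : ∀ m, ∀ x ∈ S', τ m x ∈ S') [FiniteDimensional ℂ S']
    (Λ : J →ₗ[ℂ] ℂ) (c : M →* ℂˣ) (hker : ∀ x ∈ S, Λ x = 0 ↔ x ∈ S') (hne : ∃ x ∈ S, Λ x ≠ 0) (hequiv : ∀ m, ∀ x ∈ S, Λ (τ m x) = c m * Λ x)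
    (χ : M → ℂ) [Decidable (χ = fun m => ((c m : ℂˣ) : ℂ))] :
    FiniteDimensional ℂ S ∧
      finrank ℂ ↥(⨅ m, Module.End.maxGenEigenspace ((τ m).restrict (fun x hx => hS m x hx)) (χ m)) =
        finrank ℂ ↥(⨅ m, Module.End.maxGenEigenspace ((τ m).restrict (fun x hx => hS' m x hx)) (χ m)) +
          (if χ = fun m => ((c m : ℂˣ) : ℂ) then 1 else 0) := by
  classical
  -- `S` is finite-dimensional: `S ≤ S' ⊔ ℂ x₀`
  obtain ⟨x₀, hx₀S, hx₀⟩ := hne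
  have hSle : S ≤ S' ⊔ Submodule.span ℂ {x₀} := by
    intro x hx
    have hdiff : x - (Λ x / Λ x₀) • x₀ ∈ S' := by
      refine (hker _ (S.sub_mem hx (S.smul_mem _ hx₀S))).1 ?_
      rw [map_sub, map_smul, smul_eq_mul, div_mul_cancel₀ _ hx₀, sub_self]
    have : x = (x - (Λ x / Λ x₀) • x₀) + (Λ x / Λ x₀) • x₀ := by abel
    rw [this]
    exact Submodule.add_mem_sup hdiff (Submodule.smul_mem _ _ (Submodule.subset_span rfl))
  haveI : FiniteDimensional ℂ ↥(S' ⊔ Submodule.span ℂ {x₀}) := Submodule.finiteDimensional_sup _ _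
  haveI hSfd : FiniteDimensional ℂ S := Submodule.finiteDimensional_of_le hSle
  refine ⟨hSfd, ?_⟩
  -- `S'` seen inside `S`, and the quotient line `Q = S ⁄ S'` (same universe as `J`)
  set S'' : Submodule ℂ S := Submodule.comap S.subtype S' with hS''
  have hS''st : ∀ m, ∀ v ∈ S'', (τ m).restrict (fun x hx => hS m x hx) v ∈ S'' := fun m v hv => hS' m v hv
  -- the three representations
  let τS : Representation ℂ M S :=
    { toFun := fun m => (τ m).restrict (fun x hx => hS m x hx)
      map_one' := by ext x; simp
      map_mul' := fun m m' => restrict_mul_eq τ S hS m m' }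
  let τS' : Representation ℂ M S' :=
    { toFun := fun m => (τ m).restrict (fun x hx => hS' m x hx)
      map_one' := by ext x; simp
      map_mul' := fun m m' => restrict_mul_eq τ S' hS' m m' }
  have hτS : ∀ m m' : M, Commute (τS m) (τS m') := fun m m' => by
    ext x; change ((τ m * τ m') (x : J) : J) = (τ m' * τ m) (x : J); rw [(hτ m m').eq]
  have hqst : ∀ m, S'' ≤ S''.comap (τS m) := fun m v hv => hS''st m v hv
  let τQ : Representation ℂ M (S ⧸ S'') := τS.quotient S'' hqst
  have hτQ_mk : ∀ m (v : S), τQ m (Submodule.Quotient.mk v) = Submodule.Quotient.mk (τS m v) := fun m v => rfl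
  have hτQ : ∀ m m' : M, Commute (τQ m) (τQ m') := fun m m' => by
    refine LinearMap.ext fun q => ?_
    obtain ⟨v, rfl⟩ := Submodule.Quotient.mk_surjective S'' q
    change τQ m (τQ m' (Submodule.Quotient.mk v)) = τQ m' (τQ m (Submodule.Quotient.mk v))
    rw [hτQ_mk, hτQ_mk, hτQ_mk, hτQ_mk, ← Module.End.mul_apply, (hτS m m').eq, Module.End.mul_apply]
  -- `M` acts on the quotient line by `c`
  have hΛS'' : ∀ v : S, Λ (v : J) = 0 ↔ v ∈ S'' := fun v => by rw [hS'', Submodule.mem_comap, Submodule.coe_subtype]; exact hker v v.2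
  have hτQc : ∀ m (q : S ⧸ S''), τQ m q = (fun m => ((c m : ℂˣ) : ℂ)) m • q := by
    intro m q
    obtain ⟨v, rfl⟩ := Submodule.Quotient.mk_surjective S'' q
    rw [hτQ_mk, ← Submodule.Quotient.mk_smul, Submodule.Quotient.eq]
    refine (hΛS'' _).1 ?_
    change Λ ((τ m v : J) - ((c m : ℂˣ) : ℂ) • (v : J)) = 0
    rw [map_sub, map_smul, hequiv m v v.2, smul_eq_mul, sub_self]
  -- the maps `S' ↪ S ↠ S ⁄ S''`
  let ι : S' →ₗ[ℂ] S := Submodule.inclusion hle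
  let p : S →ₗ[ℂ] S ⧸ S'' := S''.mkQ
  have hι : ∀ m v, ι (τS' m v) = τS m (ι v) := fun m v => rfl
  have hp : ∀ m v, p (τS m v) = τQ m (p v) := fun m v => rfl
  have hιinj : Injective ι := Submodule.inclusion_injective hle
  have hexact : Exact ι p := by
    intro v
    constructor
    · intro hv
      have hv' : v ∈ S'' := (Submodule.Quotient.mk_eq_zero S'').1 hv
      exact ⟨⟨v, hv'⟩, Subtype.ext rfl⟩
    · rintro ⟨w, rfl⟩
      exact (Submodule.Quotient.mk_eq_zero S'').2 (show (w : J) ∈ S' from w.2)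
  have hpsurj : Surjective p := Submodule.mkQ_surjective S''
  have hadd := finrank_weightSpace_eq_add_of_exact τS' τS τQ hτS hτQ ι p hι hp hιinj hexact hpsurj χ
  -- the quotient is a line: `Λ` induces `S ⁄ S'' ≃ ℂ`
  have hkerΛ : LinearMap.ker (Λ ∘ₗ S.subtype) = S'' := by
    ext v; rw [LinearMap.mem_ker]; exact hΛS'' v
  have hsurjΛ : Surjective (Λ ∘ₗ S.subtype) := fun z => ⟨(z / Λ x₀) • ⟨x₀, hx₀S⟩, by
    simp only [LinearMap.coe_comp, Function.comp_apply, map_smul, Submodule.coe_subtype, smul_eq_mul]; exact div_mul_cancel₀ _ hx₀⟩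
  have hQ1 : finrank ℂ (S ⧸ S'') = 1 := by
    rw [← hkerΛ, LinearEquiv.finrank_eq ((Λ ∘ₗ S.subtype).quotKerEquivOfSurjective hsurjΛ), Module.finrank_self]
  haveI : FiniteDimensional ℂ (S ⧸ S'') := inferInstance
  have hchar : finrank ℂ ↥(⨅ m, Module.End.maxGenEigenspace (τQ m) (χ m)) = if χ = fun m => ((c m : ℂˣ) : ℂ) then 1 else 0 := by
    split_ifs with h
    · rw [h, weightSpace_eq_top_of_forall_apply_eq_smul τQ _ hτQc, finrank_top, hQ1]
    · rw [weightSpace_eq_bot_of_forall_apply_eq_smul_of_ne τQ _ hτQc h, finrank_bot]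
  rw [hchar] at hadd
  exact hadd

/-! ## §3 The filtration theorem -/

open scoped Classical in
/-- **EXPONENT MULTIPLICITIES ALONG A FILTRATION BY LINES.**  `τ` a representation of `M` on `J` by pairwise commuting operators; `F : ℕ → Submodule ℂ J` with `F 0 = ⊤`,
`F n = ⊥`, `F (k+1) ≤ F k`, each `F k` stable; for each `k < n` a functional `Λ k` with `ker (Λ k) ∩ F k = F (k+1)`, `Λ k|_{F k} ≠ 0` and `Λ k (τ(m) x) = c k m · Λ k x` on `F k`.
Then `J` is finite-dimensional and **`dim J_χ = #{k < n : χ = c_k}`** for every `χ : M → ℂ` (E1a multiplicity, `J_χ = ⨅_m maxGenEigenspace (τ m) (χ m)`).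
[cite: BernsteinZelevinsky1977, §2.12, Cor. 2.13 (c)] [cite: Casselman1995, §6.3 Thm. 6.3.5] -/
theorem finrank_weightSpace_eq_card_of_lineFiltration (τ : Representation ℂ M J) (hτ : ∀ m m' : M, Commute (τ m) (τ m'))
    (n : ℕ) (F : ℕ → Submodule ℂ J) (h0 : F 0 = ⊤) (hn : F n = ⊥) (hanti : ∀ k, F (k + 1) ≤ F k) (hst : ∀ k m, ∀ x ∈ F k, τ m x ∈ F k)
    (Λ : ℕ → (J →ₗ[ℂ] ℂ)) (c : ℕ → (M →* ℂˣ))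
    (hker : ∀ k < n, ∀ x ∈ F k, Λ k x = 0 ↔ x ∈ F (k + 1)) (hne : ∀ k < n, ∃ x ∈ F k, Λ k x ≠ 0)
    (hequiv : ∀ k < n, ∀ m, ∀ x ∈ F k, Λ k (τ m x) = c k m * Λ k x) (χ : M → ℂ) :
    FiniteDimensional ℂ J ∧
      finrank ℂ ↥(⨅ m, Module.End.maxGenEigenspace (τ m) (χ m)) =
        ((Finset.range n).filter fun k => χ = fun m => ((c k m : ℂˣ) : ℂ)).card := by
  classical
  -- descending induction: the statement for the stable submodule `F k`, `k + j = n`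
  have key : ∀ j k, k + j = n → ∃ _ : FiniteDimensional ℂ ↥(F k),
      finrank ℂ ↥(⨅ m, Module.End.maxGenEigenspace ((τ m).restrict (fun x hx => hst k m x hx)) (χ m)) =
        ((Finset.Ico k n).filter fun i => χ = fun m => ((c i m : ℂˣ) : ℂ)).card := by
    intro j
    induction j with
    | zero =>
      intro k hk
      rw [Nat.add_zero] at hk
      subst hk
      haveI : FiniteDimensional ℂ ↥(F k) := by rw [hn]; infer_instance
      refine ⟨inferInstance, ?_⟩
      haveI : Subsingleton ↥(F k) := by rw [hn]; infer_instance
      rw [Finset.Ico_self, Finset.filter_empty, Finset.card_empty]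
      exact Module.finrank_zero_of_subsingleton
    | succ j ih =>
      intro k hk
      obtain ⟨hfd, hcount⟩ := ih (k + 1) (by omega)
      have hkn : k < n := by omega
      obtain ⟨hfdS, hstep⟩ := finrank_weightSpace_step τ hτ (F k) (F (k + 1)) (hanti k) (hst k) (hst (k + 1))
        (Λ k) (c k) (hker k hkn) (hne k hkn) (hequiv k hkn) χ
      refine ⟨hfdS, ?_⟩
      rw [hstep, hcount, ← Finset.insert_Ico_add_one_left_eq_Ico hkn, Finset.filter_insert]
      split_ifs with h
      · rw [Finset.card_insert_of_notMem (by simp), add_comm]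
      · rw [add_zero]
  obtain ⟨hfd, hcount⟩ := key n 0 (Nat.zero_add n)
  haveI : FiniteDimensional ℂ ↥(F 0) := hfd
  haveI : FiniteDimensional ℂ J := by
    rw [h0] at hfd
    exact (Submodule.topEquiv : (⊤ : Submodule ℂ J) ≃ₗ[ℂ] J).finiteDimensional
  refine ⟨inferInstance, ?_⟩
  rw [← Finset.range_eq_Ico] at hcount
  rw [← hcount]
  -- transport along `F 0 = ⊤ ≃ J`
  symm
  let e : ↥(F 0) ≃ₗ[ℂ] J := (LinearEquiv.ofEq _ _ h0).trans Submodule.topEquiv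
  let τ0 : Representation ℂ M ↥(F 0) :=
    { toFun := fun m => (τ m).restrict (fun x hx => hst 0 m x hx)
      map_one' := by ext x; simp
      map_mul' := fun m m' => restrict_mul_eq τ (F 0) (hst 0) m m' }
  exact finrank_weightSpace_eq_of_linearEquiv τ0 τ e (fun m v => rfl) χ

end Summit.HodgeConjecture.HodgeConjecture.Cruxes.H413.K2E3JacquetFiltrationMultiplicity
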